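import Mathlib
import HarnessLib
import Summits.HubbardSuperconductivity.HubbardSuperconductivity.Theorems.KLProgrammeC4aCooperProfileRows

/-!
# Route `KLProgramme` — crux C4a, S3 brick (B4) «(U1)-HYBRID» part D-3c (ii): THE η-SCALED FLOOR of the level-`0` pp partner band away from its two crossings near the
# Cooper configuration — `(Gδ₀/4)·|ϑ − π| ≤ |ē(0,t;0,ϑ,θ)|` for `t ∈ [−π/2, 3π/2]` with `|t|, |t − ϑ| > δ₀`

Cell `gate-hubbard-kl`, seat hubbard-kl-k3c3-p3 (g37; row «implicit-function / monotonicity route for μ(n)»).  Located brick for the (C)-closer lane / the (M4)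
assembly of the first-order ϑ-layer (stub (C) `stub_twoLeg_curvature` of `KLRegimeEngineV17F2`, stmt-HubbardSuperconductivity-20437), memo
HOME/hubbard-kl-k3c3-p3/U1-CAUSTIC-SUP.md §19 addendum (c) «D-3: the near-(C) ratio-form key lemma», row `κ ∝ |η|`.

THE MECHANISM (`ρ = e = 0`, `η = ϑ − π`, `S₀ = Φ(0,θ) + Φ(0,ϑ+θ) = −(Φ(0,θ+η) − Φ(0,θ))` by the half-turn symmetry of the Fermi curve).  With `P₀ = −Φ(0,t+θ) = Φ(0,t+θ+π)`
(on shell, `e_K(P₀) = 0`):  `ē(0,t) = e_K(P₀ + S₀) = De_K(P₀)[S₀] + O(K₂‖S₀‖²)` (the gradient is `K₂`-Lipschitz), `S₀ = −η·∂_sΦ(0,θ) + O(msD₂η²)` (the tangent is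
`msD₂`-Lipschitz), and the GAUSS-MAP LAW `…C4aTransversalityGaussLaw.abs_fderiv_frameLevel_levelPoint_tangent_ge` gives `|De_K(Φ(0,t+θ+π))[∂_sΦ(0,θ)]| ≥ G·min(‖t+π‖_𝕋, ‖t‖_𝕋)`,
`G = (2/π)(Dt−2A)u_min·(u_min w/(4+2A))`; on the window `t ∈ [−π/2, 3π/2]`, `|t| > δ₀`, `|t − ϑ| > δ₀` (`δ₀ ≤ π/2`, `|η| ≤ δ₀/2`) that minimum is `≥ δ₀/2`.  Hence
`|ē(0,t)| ≥ |η|·(Gδ₀/2 − (K₁msD₂ + K₂msD₁²)|η|) ≥ (Gδ₀/4)|η|` under the row `(K₁msD₂ + K₂msD₁²)η₀ ≤ Gδ₀/4`.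
* `min_torusDist_ge_of_window` — the torus bookkeeping of the window;
* `norm_levelPoint_taylor_two_le` — `‖Φ(0,θ+η) − Φ(0,θ) − η·∂_sΦ(0,θ)‖ ≤ msD₂η²`;
* `abs_frameLevel_taylor_two_le` — `|e_K(P + S) − e_K(P) − De_K(P)[S]| ≤ K₂‖S‖²`;
* **`abs_partnerBand_pp_level_zero_ge_cooper`** (HEADLINE) — the floor.
Sizes binder shape + clause (i) `GeomConstants` of `FrameOK`; pure calculus on landed objects; nothing asserts (C), K3 or superconductivity.
References: FST II CPAM 51 (1998) §3 Thm 3.5 [cite: FeldmanSalmhoferTrubowitz1998]; BGM 2003 §7.1 Lemma 7.1 (A1.9) [cite: BenfattoGiulianiMastropietro2003];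
BGM 2006 §2.4 (2.40) [cite: BenfattoGiulianiMastropietro2006].
-/

noncomputable section

namespace Summit.HubbardSuperconductivity.HubbardSuperconductivity.Theorems.C4a

set_option linter.dupNamespace false -- summit = problem name (single-conjunct summit), D-0017

open Real Set Filter Metric
open scoped Topology
open Literature.MathematicalPhysics.QuantumLattice Literature.MathematicalPhysics.QuantumLattice.BandSectorCounting Literature.Probability.LatticeModels
open Literature.MathematicalPhysics.QuantumLattice.FermiRG
open Summit.HubbardSuperconductivity.HubbardSuperconductivity.Theorems.KLRegimeSplit
open Summit.HubbardSuperconductivity.HubbardSuperconductivity.Theorems.DispersionFlow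
open Summit.HubbardSuperconductivity.HubbardSuperconductivity.Theorems.PerturbedFermiCurve

/-! ## §1 Torus bookkeeping of the window -/

/-- On the window `t ∈ [−π/2, 3π/2]` with `|t| > δ₀`, `|t − ϑ| > δ₀` (`δ₀ ≤ π/2`, `|ϑ − π| ≤ δ₀/2`): `δ₀/2 ≤ min(‖t + π‖_𝕋, ‖t‖_𝕋)`. -/
theorem min_torusDist_ge_of_window {δ₀ ϑ t : ℝ} (hδ₀π : δ₀ ≤ π / 2) (hϑ : |ϑ - π| ≤ δ₀ / 2) (htI : t ∈ Icc (-(π / 2)) (3 * π / 2))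
    (ht0 : δ₀ < |t - 0|) (htϑ : δ₀ < |t - ϑ|) : δ₀ / 2 ≤ min (torusDist (t + π)) (torusDist t) := by
  have hπ := Real.pi_pos
  have hδ₀0 : 0 ≤ δ₀ := by linarith [abs_nonneg (ϑ - π)]
  refine le_min ?_ ?_
  · rcases le_or_gt 0 t with h | h
    · -- `t ≥ 0`: `‖t + π‖ = |t − π| ≥ |t − ϑ| − |ϑ − π|`
      rw [show t + π = (t - π) + (1 : ℤ) * (2 * π) by push_cast; ring, torusDist_add_int_mul_two_pi,
        torusDist_eq_abs_of_abs_le_pi (by rw [abs_le]; constructor <;> linarith [htI.2])]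
      have h2 : |t - ϑ| ≤ |t - π| + |ϑ - π| := by
        have := abs_add_le (t - π) (π - ϑ); rwa [show t - π + (π - ϑ) = t - ϑ by ring, abs_sub_comm π ϑ] at this
      linarith
    · -- `t < 0`: `t + π ∈ [π/2, π)`
      rw [torusDist_eq_abs_of_abs_le_pi (by rw [abs_le]; constructor <;> linarith [htI.1]), abs_of_nonneg (by linarith [htI.1])]
      linarith [htI.1]
  · rcases le_or_gt t π with h | h
    · rw [torusDist_eq_abs_of_abs_le_pi (by rw [abs_le]; constructor <;> linarith [htI.1])]
      rw [sub_zero] at ht0; linarith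
    · rw [show t = (t - 2 * π) + (1 : ℤ) * (2 * π) by push_cast; ring, torusDist_add_int_mul_two_pi,
        torusDist_eq_abs_of_abs_le_pi (by rw [abs_le]; constructor <;> linarith [htI.2]), abs_of_neg (by linarith [htI.2])]
      linarith [htI.2]

/-! ## §2 Two Taylor remainders -/

section Sizes

variable {K : TrigPolyC4v} {A : ℝ} (hA : ∀ p : Momentum, ∀ j ≤ 2, ‖iteratedFDeriv ℝ j (frameShift K) p‖ ≤ A) (hA20 : A ≤ 1 / 20)
  (hd : klCurveD ≤ (bandBounds (show (-4 : ℝ) < -1.1 by norm_num) (show (-1.1 : ℝ) ≤ -0.1 by norm_num)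
    (show (-0.1 : ℝ) < 0 by norm_num)).Dtmin - 2 * A)
  {μ r : ℝ} (hr : 0 < r) (hlo : (-1.1 : ℝ) < μ - r - A) (hhi : μ + r + A < -0.1)
  {A₃ A₄ : ℝ} (hA₃ : ∀ p : Momentum, ‖iteratedFDeriv ℝ 3 (frameShift K) p‖ ≤ A₃)
  (hA₄ : ∀ p : Momentum, ‖iteratedFDeriv ℝ 4 (frameShift K) p‖ ≤ A₄)
  {K₁ K₂ : ℝ} (hK₁ : ∀ p : Momentum, ‖fderiv ℝ (frameLevel μ K) p‖ ≤ K₁) (hK₂ : ∀ p : Momentum, ‖iteratedFDeriv ℝ 2 (frameLevel μ K) p‖ ≤ K₂)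
include hA hA20 hd hr hlo hhi hA₃ hA₄ hK₁ hK₂

omit hr hK₁ hK₂ in
/-- **Second-order Taylor remainder of a level curve in the angle**: `‖Φ(x,θ+η) − Φ(x,θ) − η·∂_sΦ(x,θ)‖ ≤ msD₂·η²` (`|x| < r`). -/
theorem norm_levelPoint_taylor_two_le {x : ℝ} (hx : |x| < r) (θ η : ℝ) :
    ‖levelPoint μ K x (θ + η) - levelPoint μ K x θ - η • iteratedDeriv 1 (levelPoint μ K x) θ‖ ≤ msD A₃ A₄ 2 * η ^ 2 := by
  set v := iteratedDeriv 1 (levelPoint μ K x) θ with hv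
  set k : ℝ → Momentum := fun s => levelPoint μ K x (θ + s) - s • v with hk
  have hkd : ∀ s, HasDerivAt k (iteratedDeriv 1 (levelPoint μ K x) (θ + s) - (1 : ℝ) • v) s := fun s =>
    (HasDerivAt.comp_const_add θ s (hasDerivAt_levelPoint_angle hA hd hlo hhi hx (θ + s))).sub ((hasDerivAt_id s).smul_const v)
  have hdiff : ∀ s ∈ uIcc 0 η, DifferentiableAt ℝ k s := fun s _ => (hkd s).differentiableAt
  have hbound : ∀ s ∈ uIcc 0 η, ‖deriv k s‖ ≤ msD A₃ A₄ 2 * |η| := by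
    intro s hs
    rw [(hkd s).deriv, one_smul, hv]
    have h := norm_iteratedDeriv_levelPoint_sub_le_angle hA hA20 hd hlo hhi hA₃ hA₄ hx (i := 1) (by norm_num) (θ + s) θ
    rw [show θ + s - θ = s by ring] at h
    refine h.trans (mul_le_mul_of_nonneg_left ?_ ((norm_nonneg _).trans
      (norm_iteratedDeriv_levelPoint_le hA hA20 hd hlo hhi hA₃ hA₄ hx (i := 2) (by norm_num) (by norm_num) θ)))
    rcases mem_uIcc.1 hs with ⟨h1, h2⟩ | ⟨h1, h2⟩
    · rw [abs_of_nonneg h1, abs_of_nonneg (h1.trans h2)]; exact h2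
    · rw [abs_of_nonpos h2, abs_of_nonpos (h1.trans h2)]; linarith
  have h := (convex_uIcc 0 η).norm_image_sub_le_of_norm_deriv_le hdiff hbound left_mem_uIcc right_mem_uIcc
  have hk0 : k 0 = levelPoint μ K x θ := by simp [hk]
  have hkη : k η = levelPoint μ K x (θ + η) - η • v := rfl
  rw [hkη, hk0, sub_zero, Real.norm_eq_abs] at h
  calc ‖levelPoint μ K x (θ + η) - levelPoint μ K x θ - η • v‖ = ‖levelPoint μ K x (θ + η) - η • v - levelPoint μ K x θ‖ := by abel_nf
    _ ≤ msD A₃ A₄ 2 * |η| * |η| := h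
    _ = msD A₃ A₄ 2 * η ^ 2 := by rw [mul_assoc, abs_mul_abs_self, sq]

omit hA hA20 hd hr hlo hhi hA₃ hA₄ hK₁ in
/-- **Second-order Taylor remainder of the frame band**: `|e_K(P + S) − e_K(P) − De_K(P)[S]| ≤ K₂·‖S‖²` (the gradient is `K₂`-Lipschitz). -/
theorem abs_frameLevel_taylor_two_le (P S : Momentum) :
    |frameLevel μ K (P + S) - frameLevel μ K P - fderiv ℝ (frameLevel μ K) P S| ≤ K₂ * ‖S‖ ^ 2 := by
  have hFd : Differentiable ℝ (frameLevel μ K) := (EngineV8.contDiff_frameLevel μ K (n := 1)).differentiable one_ne_zero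
  have hf : ∀ x ∈ closedBall P ‖S‖, HasFDerivWithinAt (frameLevel μ K) (fderiv ℝ (frameLevel μ K) x) (closedBall P ‖S‖) x :=
    fun x _ => (hFd x).hasFDerivAt.hasFDerivWithinAt
  have hbound : ∀ x ∈ closedBall P ‖S‖, ‖fderiv ℝ (frameLevel μ K) x - fderiv ℝ (frameLevel μ K) P‖ ≤ K₂ * ‖S‖ := by
    intro x hx
    refine (norm_fderiv_frameLevel_sub_le hK₂ x P).trans (mul_le_mul_of_nonneg_left ?_ ((norm_nonneg _).trans (hK₂ 0)))
    rwa [mem_closedBall, dist_eq_norm] at hx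
  have hP : P ∈ closedBall P ‖S‖ := mem_closedBall_self (norm_nonneg _)
  have hPS : P + S ∈ closedBall P ‖S‖ := by rw [mem_closedBall, dist_eq_norm, add_sub_cancel_left]
  have h := (convex_closedBall P ‖S‖).norm_image_sub_le_of_norm_hasFDerivWithin_le' hf hbound hP hPS
  rw [add_sub_cancel_left, Real.norm_eq_abs] at h
  calc _ ≤ K₂ * ‖S‖ * ‖S‖ := h
    _ = K₂ * ‖S‖ ^ 2 := by ring

/-! ## §3 The floor -/

/-- **THE η-SCALED FLOOR OF THE LEVEL-`0` pp PARTNER BAND NEAR COOPER** (HEADLINE; see the module docstring): under clause (i) of `FrameOK`, at `ρ = e = 0`, with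
`G = (2/π)(Dt−2A)u_min·(u_min w/(4+2A))` and thresholds `δ₀ ≤ π/2`, `η₀ ≤ δ₀/2`, `(K₁msD₂ + K₂msD₁²)·η₀ ≤ G·δ₀/4`: for `|ϑ − π| ≤ η₀` and every
`t ∈ [−π/2, 3π/2]` with `δ₀ < |t|`, `δ₀ < |t − ϑ|`, `(Gδ₀/4)·|ϑ − π| ≤ |e_K(Φ(0,θ) + Φ(0,ϑ+θ) − Φ(0,t+θ))|`. [cite: BenfattoGiulianiMastropietro2003, §7.1 Lemma 7.1 (A1.9)] -/
theorem abs_partnerBand_pp_level_zero_ge_cooper {Kc r₀ g₀ w : ℝ} (hG : GeomConstants (frameLevel μ K) Kc r₀ g₀ w) {δ₀ η₀ : ℝ} (hδ₀π : δ₀ ≤ π / 2)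
    (hη₀ : η₀ ≤ δ₀ / 2)
    (hη₀row : (K₁ * msD A₃ A₄ 2 + K₂ * msD A₃ A₄ 1 ^ 2) * η₀ ≤
      (2 / π * (((bandBounds (show (-4 : ℝ) < -1.1 by norm_num) (show (-1.1 : ℝ) ≤ -0.1 by norm_num) (show (-0.1 : ℝ) < 0 by norm_num)).Dtmin - 2 * A) *
        (bandBounds (show (-4 : ℝ) < -1.1 by norm_num) (show (-1.1 : ℝ) ≤ -0.1 by norm_num) (show (-0.1 : ℝ) < 0 by norm_num)).umin) *
        ((bandBounds (show (-4 : ℝ) < -1.1 by norm_num) (show (-1.1 : ℝ) ≤ -0.1 by norm_num) (show (-0.1 : ℝ) < 0 by norm_num)).umin * w / (4 + 2 * A))) * δ₀ / 4)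
    {ϑ : ℝ} (hϑ : |ϑ - π| ≤ η₀) (θ : ℝ) {t : ℝ} (htI : t ∈ Icc (-(π / 2)) (3 * π / 2)) (ht0 : δ₀ < |t - 0|) (htϑ : δ₀ < |t - ϑ|) :
    (2 / π * (((bandBounds (show (-4 : ℝ) < -1.1 by norm_num) (show (-1.1 : ℝ) ≤ -0.1 by norm_num) (show (-0.1 : ℝ) < 0 by norm_num)).Dtmin - 2 * A) *
        (bandBounds (show (-4 : ℝ) < -1.1 by norm_num) (show (-1.1 : ℝ) ≤ -0.1 by norm_num) (show (-0.1 : ℝ) < 0 by norm_num)).umin) *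
        ((bandBounds (show (-4 : ℝ) < -1.1 by norm_num) (show (-1.1 : ℝ) ≤ -0.1 by norm_num) (show (-0.1 : ℝ) < 0 by norm_num)).umin * w / (4 + 2 * A))) * δ₀ / 4 *
        |ϑ - π| ≤
      |frameLevel μ K (pairSumPath μ K 0 ϑ θ 0 - levelPoint μ K 0 (t + θ))| := by
  set B := bandBounds (show (-4 : ℝ) < -1.1 by norm_num) (show (-1.1 : ℝ) ≤ -0.1 by norm_num) (show (-0.1 : ℝ) < 0 by norm_num) with hBdef
  set G : ℝ := 2 / π * ((B.Dtmin - 2 * A) * B.umin) * (B.umin * w / (4 + 2 * A)) with hGdef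
  have hπ := Real.pi_pos
  have h0 : |(0 : ℝ)| < r := by simpa using hr
  have h0' : |(0 : ℝ)| < r₀ := by simpa using hG.r₀_pos
  have hADt : 2 * A < B.Dtmin := by have := klCurveD_pos; linarith only [this, hd]
  have hDt : 0 < B.Dtmin - 2 * A := by linarith only [hADt]
  have hA0 : 0 ≤ A := le_trans (norm_nonneg _) (hA 0 0 (by norm_num))
  have hG0 : 0 ≤ G :=
    mul_nonneg (mul_nonneg (by positivity) (mul_nonneg hDt.le B.umin_pos.le)) (by have := B.umin_pos; have := hG.wmin_pos; positivity)
  have hK₁0 : 0 ≤ K₁ := (norm_nonneg _).trans (hK₁ 0)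
  have hK₂0 : 0 ≤ K₂ := (norm_nonneg _).trans (hK₂ 0)
  have hδ₀0 : 0 ≤ δ₀ := by linarith [abs_nonneg (ϑ - π), hϑ.trans hη₀]
  set η : ℝ := ϑ - π with hηdef
  have hηδ : |η| ≤ δ₀ / 2 := hϑ.trans hη₀
  -- the objects
  set S₀ : Momentum := pairSumPath μ K 0 ϑ θ 0 with hS₀
  set P₀ : Momentum := -levelPoint μ K 0 (t + θ) with hP₀
  set v : Momentum := iteratedDeriv 1 (levelPoint μ K 0) θ with hv
  set R : Momentum := levelPoint μ K 0 (θ + η) - levelPoint μ K 0 θ - η • v with hR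
  have hS₀eq : S₀ = -(η • v + R) := by
    have h1 : levelPoint μ K 0 (ϑ + θ) = -levelPoint μ K 0 (θ + η) := by
      rw [show ϑ + θ = (θ + η) + π by rw [hηdef]; ring, levelPoint_add_pi]
    simp only [hS₀, pairSumPath, add_zero, hR]
    rw [h1]; abel
  have hP₀eq : P₀ = levelPoint μ K 0 (t + θ + π) := by rw [hP₀, levelPoint_add_pi]
  have hval : frameLevel μ K (pairSumPath μ K 0 ϑ θ 0 - levelPoint μ K 0 (t + θ)) = frameLevel μ K (P₀ + S₀) := by
    rw [hP₀]; congr 1; abel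
  -- sizes
  have hS₀n : ‖S₀‖ ≤ msD A₃ A₄ 1 * |η| := by
    have h := norm_pairSumPath_zero_le hA hA20 hd hr hlo hhi hA₃ hA₄ h0 ϑ θ
    rwa [abs_zero, zero_div, zero_add] at h
  have hRn : ‖R‖ ≤ msD A₃ A₄ 2 * η ^ 2 := norm_levelPoint_taylor_two_le hA hA20 hd hlo hhi hA₃ hA₄ h0 θ η
  have hP₀0 : frameLevel μ K P₀ = 0 := frameLevel_neg_levelPoint_tube hA hlo hhi h0 (t + θ)
  have hTaylor := abs_frameLevel_taylor_two_le hK₂ (μ := μ) (K := K) P₀ S₀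
  rw [hP₀0, sub_zero] at hTaylor
  -- the Gauss-map floor of the linear term
  have hGauss := abs_fderiv_frameLevel_levelPoint_tangent_ge hA hd hlo hhi hG h0 h0 h0' (t + θ + π) θ
  rw [sub_self, abs_zero, mul_zero, zero_div, sub_zero, show t + θ + π - θ = t + π by ring, show t + π - π = t by ring, ← hP₀eq] at hGauss
  have hmin := min_torusDist_ge_of_window hδ₀π hηδ htI ht0 htϑ
  have hlin : G * (δ₀ / 2) ≤ |fderiv ℝ (frameLevel μ K) P₀ v| := by
    refine le_trans ?_ hGauss
    calc G * (δ₀ / 2) ≤ G * min (torusDist (t + π)) (torusDist t) := mul_le_mul_of_nonneg_left hmin hG0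
      _ = 2 / π * ((B.Dtmin - 2 * A) * B.umin) * (B.umin * w / (4 + 2 * A) * min (torusDist (t + π)) (torusDist t)) := by rw [hGdef]; ring
  -- the linear term at S₀
  have hφS₀ : fderiv ℝ (frameLevel μ K) P₀ S₀ = -(η * fderiv ℝ (frameLevel μ K) P₀ v) - fderiv ℝ (frameLevel μ K) P₀ R := by
    rw [hS₀eq, map_neg, map_add, map_smul, smul_eq_mul]; ring
  have hφR : |fderiv ℝ (frameLevel μ K) P₀ R| ≤ K₁ * (msD A₃ A₄ 2 * η ^ 2) := by
    rw [← Real.norm_eq_abs]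
    exact (ContinuousLinearMap.le_opNorm _ _).trans (mul_le_mul (hK₁ _) hRn (norm_nonneg _) hK₁0)
  have hrem : K₂ * ‖S₀‖ ^ 2 ≤ K₂ * (msD A₃ A₄ 1 ^ 2 * η ^ 2) := by
    refine mul_le_mul_of_nonneg_left ?_ hK₂0
    calc ‖S₀‖ ^ 2 ≤ (msD A₃ A₄ 1 * |η|) ^ 2 := pow_le_pow_left₀ (norm_nonneg _) hS₀n 2
      _ = msD A₃ A₄ 1 ^ 2 * η ^ 2 := by rw [mul_pow, sq_abs]
  -- assemble: |f| ≥ |η|·G·δ₀/2 − K₁msD₂η² − K₂msD₁²η² ≥ (Gδ₀/4)|η|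
  have hmain : |η| * (G * (δ₀ / 2)) - K₁ * (msD A₃ A₄ 2 * η ^ 2) - K₂ * (msD A₃ A₄ 1 ^ 2 * η ^ 2) ≤ |frameLevel μ K (P₀ + S₀)| := by
    have h1 : |fderiv ℝ (frameLevel μ K) P₀ S₀| - K₂ * ‖S₀‖ ^ 2 ≤ |frameLevel μ K (P₀ + S₀)| := by
      have := abs_sub_abs_le_abs_sub (fderiv ℝ (frameLevel μ K) P₀ S₀) (frameLevel μ K (P₀ + S₀))
      rw [abs_sub_comm] at this; linarith
    have h2 : |η| * |fderiv ℝ (frameLevel μ K) P₀ v| - |fderiv ℝ (frameLevel μ K) P₀ R| ≤ |fderiv ℝ (frameLevel μ K) P₀ S₀| := by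
      rw [hφS₀, ← abs_mul]
      have := abs_sub_abs_le_abs_sub (-(η * (fderiv ℝ (frameLevel μ K) P₀) v)) ((fderiv ℝ (frameLevel μ K) P₀) R)
      rw [abs_neg] at this; linarith
    have h3 : |η| * (G * (δ₀ / 2)) ≤ |η| * |fderiv ℝ (frameLevel μ K) P₀ v| := mul_le_mul_of_nonneg_left hlin (abs_nonneg _)
    linarith
  have hsmall : K₁ * (msD A₃ A₄ 2 * η ^ 2) + K₂ * (msD A₃ A₄ 1 ^ 2 * η ^ 2) ≤ G * δ₀ / 4 * |η| := by
    have h1 : (K₁ * msD A₃ A₄ 2 + K₂ * msD A₃ A₄ 1 ^ 2) * |η| ≤ G * δ₀ / 4 := by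
      refine le_trans (mul_le_mul_of_nonneg_left (hϑ : |η| ≤ η₀) ?_) hη₀row
      have := (msD_one_pos A₃ A₄).le
      have : 0 ≤ msD A₃ A₄ 2 := (norm_nonneg _).trans (norm_iteratedDeriv_levelPoint_le hA hA20 hd hlo hhi hA₃ hA₄ h0 (i := 2) (by norm_num) (by norm_num) 0)
      positivity
    have h2 := mul_le_mul_of_nonneg_right h1 (abs_nonneg η)
    calc K₁ * (msD A₃ A₄ 2 * η ^ 2) + K₂ * (msD A₃ A₄ 1 ^ 2 * η ^ 2) = (K₁ * msD A₃ A₄ 2 + K₂ * msD A₃ A₄ 1 ^ 2) * |η| * |η| := by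
          rw [mul_assoc, abs_mul_abs_self]; ring
      _ ≤ G * δ₀ / 4 * |η| := h2
  rw [hval]
  calc G * δ₀ / 4 * |η| = |η| * (G * (δ₀ / 2)) - G * δ₀ / 4 * |η| := by ring
    _ ≤ |η| * (G * (δ₀ / 2)) - K₁ * (msD A₃ A₄ 2 * η ^ 2) - K₂ * (msD A₃ A₄ 1 ^ 2 * η ^ 2) := by linarith
    _ ≤ _ := hmain

end Sizes

end Summit.HubbardSuperconductivity.HubbardSuperconductivity.Theorems.C4a

end
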